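import Literature.Geometry.Lorentzian.CoordShrinkerRicciLaplacian
import Literature.Geometry.Lorentzian.CoordCurvatureNormSq
import HarnessLib

/-!
# The Ricci tensor of a three-dimensional metric in an eigenframe, and `Δ_f Ric` on eigenvectors

Pointwise algebra for the classification of compact three-dimensional shrinking Ricci solitons by
the maximum principle for `λ_min(Ric)/R` (Eminenti–La Nave–Mantegazza 2008, §3, p. 7), in the
coordinate language of `CoordCurvature.lean`: metric components `G`, a `G_x`-orthonormal basis
`e = (e₀, e₁, e₂)` of the `3`-dimensional model space which diagonalises the Ricci form,
`Ric_x(eᵢ, ·) = μᵢ G_x(eᵢ, ·)`. We PROVE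

* `scalAt_eq_sum_of_eigenframe` — `S = Σ μᵢ`; `normSqAt_ricAt_eq_sum_of_eigenframe` —
  `|Ric|² = Σ μᵢ²`;
* `IsMetricOn.two_mul_sec_eq_of_orthonormal_three` — **in dimension three the Ricci form
  determines the sectional curvatures**: `2 G(R(e₁,e₀)e₀, e₁) = Ric(e₀,e₀) + Ric(e₁,e₁) − Ric(e₂,e₂)`
  for every orthonormal basis (Lee 2018, Prop. 8.32 (a): `Ric(eᵢ,eᵢ) = Σ_{j ≠ i} K_{ij}`);
* `IsMetricOn.rmRic_self_eq_of_eigenframe` — the quadratic curvature term of Hamilton's identity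
  on an eigenvector: `Σ_{ij} g^{ij} Ric(R(bᵢ,e₀)e₀, bⱼ) = μ₁ K₀₁ + μ₂ K₀₂`, hence
  `2 Rm(Ric)(e₀,e₀) = μ₁(μ₀ + μ₁ − μ₂) + μ₂(μ₀ + μ₂ − μ₁)`
  (`two_mul_rmRic_self_eq_of_eigenframe`);
* **`IsMetricOn.lapBilinAt_ricAt_self_of_soliton_eigenframe`** — on a gradient Ricci soliton
  `Ric + Hess f = λG`: `(ΔRic)(e₀,e₀) − (∇_{∇f}Ric)(e₀,e₀) = 2λμ₀ − μ₁(μ₀+μ₁−μ₂) − μ₂(μ₀+μ₂−μ₁)`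
  (`CoordShrinkerRicciLaplacian.lapBilinAt_ricAt_of_soliton`), the curvature input of the
  computation of `Δ(R_{ij}/R)(p)vⁱvʲ` in the printed proof.

Everything is proved; no definitions are introduced.

## References

* M. Eminenti, G. La Nave, C. Mantegazza, *Ricci solitons: the equation point of view*,
  manuscripta math. 127 (2008), §3 (p. 7). [EminentiLanaveMantegazza2008]
* J. M. Lee, *Introduction to Riemannian Manifolds*, 2nd ed. (2018), Prop. 8.32. [Lee2018]
* B. O'Neill, *Semi-Riemannian geometry*, 1983, Ch. 3, Prop. 3.36, Lemma 3.52. [ONeill1983]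
-/

noncomputable section

set_option maxSynthPendingDepth 3

open Set Filter ContinuousLinearMap Module
open scoped Topology ContDiff

namespace Literature.Geometry.Lorentzian

namespace MetricCoord

variable {E : Type*} [NormedAddCommGroup E] [NormedSpace ℝ E] [FiniteDimensional ℝ E]
  {G : E → E →L[ℝ] E →L[ℝ] ℝ} {V : Set E} {x : E}

section Eigenframe

variable {ι : Type*} [Fintype ι] [DecidableEq ι]
  (e : Basis ι ℝ E) (he : ∀ i j, G x (e i) (e j) = if i = j then 1 else 0)
  {μ : ι → ℝ} (hμ : ∀ i w, ricAt G x (e i) w = μ i * G x (e i) w)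
include he hμ

omit [Fintype ι] in
/-- `Ric(eᵢ, eⱼ) = μᵢ δᵢⱼ` in an orthonormal eigenframe. [cite: ONeill1983, Ch. 3, Lemma 3.52] -/
theorem ricAt_eigenframe_apply (i j : ι) : ricAt G x (e i) (e j) = if i = j then μ i else 0 := by
  rw [hμ, he]
  split_ifs <;> simp

/-- **`S = Σ μᵢ`** in an orthonormal eigenframe of `Ric`. [cite: ONeill1983, Ch. 3, Def. 3.53] -/
theorem scalAt_eq_sum_of_eigenframe (hi : (G x).IsInvertible) : scalAt G x = ∑ i, μ i := by
  rw [scalAt, mtrAt_eq_sum e]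
  refine Finset.sum_congr rfl fun i _ ↦ ?_
  simp only [ricAt_eigenframe_apply e he hμ, mul_ite, mul_zero, Finset.sum_ite_eq,
    Finset.mem_univ, if_true, ginv_of_orthonormal e he hi, ite_mul, one_mul, zero_mul]

/-- **`|Ric|² = Σ μᵢ²`** in an orthonormal eigenframe of `Ric`. [cite: ONeill1983, Ch. 3, pp. 60–61] -/
theorem IsMetricOn.normSqAt_ricAt_eq_sum_of_eigenframe [CompleteSpace E] (hG : IsMetricOn G V)
    (hx : x ∈ V) : normSqAt G x (ricAt G x) = ∑ i, μ i ^ 2 := by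
  have hi := hG.isInvertible x hx
  rw [hG.normSqAt_eq_sum_of_symm e hx (fun v w ↦ hG.ricAt_comm hx v w)]
  have hsharp : ∀ k, sharpAt G x (ricAt G x (e k)) = μ k • e k := fun k ↦ by
    have hform : ricAt G x (e k) = μ k • G x (e k) := by
      ext w
      rw [hμ, FunLike.coe_smul, Pi.smul_apply, smul_eq_mul]
    rw [hform, map_smul, sharpAt_apply hi]
  refine Finset.sum_congr rfl fun k _ ↦ ?_
  simp only [hsharp, map_smul, smul_eq_mul, ricAt_eigenframe_apply e he hμ, mul_ite, mul_zero,
    ginv_of_orthonormal e he hi, ite_mul, one_mul, zero_mul]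
  rw [Finset.sum_eq_single k (fun j _ hj ↦ if_neg hj) (fun h ↦ (h (Finset.mem_univ k)).elim)]
  simp [sq]

end Eigenframe

section Three

variable [CompleteSpace E] (e : Basis (Fin 3) ℝ E)
  (he : ∀ i j, G x (e i) (e j) = if i = j then 1 else 0)
include he

/-- **The Ricci form determines the sectional curvatures in dimension three** (Lee 2018,
Prop. 8.32 (a): `Ric(eᵢ,eᵢ) = Σ_{j≠i} K_{ij}` in an orthonormal basis, so
`2K₀₁ = Ric(e₀,e₀) + Ric(e₁,e₁) − Ric(e₂,e₂)`), in coordinates: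
`2 G(R(e₁,e₀)e₀, e₁) = Ric(e₀,e₀) + Ric(e₁,e₁) − Ric(e₂,e₂)`. [cite: Lee2018, Prop. 8.32] -/
theorem IsMetricOn.two_mul_sec_eq_of_orthonormal_three (hG : IsMetricOn G V) (hx : x ∈ V) :
    2 * G x (riemAt G x (e 1) (e 0) (e 0)) (e 1) =
      ricAt G x (e 0) (e 0) + ricAt G x (e 1) (e 1) - ricAt G x (e 2) (e 2) := by
  -- `K(i,j) := G(R(eᵢ,eⱼ)eⱼ, eᵢ)` is symmetric and vanishes on the diagonal
  have hK : ∀ i j, G x (riemAt G x (e i) (e j) (e j)) (e i) = G x (riemAt G x (e j) (e i) (e i)) (e j) :=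
    fun i j ↦ hG.apply_riemAt_pair_comm hx (e i) (e j) (e j) (e i)
  have hK0 : ∀ i, G x (riemAt G x (e i) (e i) (e i)) (e i) = 0 := fun i ↦ by
    have h := riemAt_swap G x (e i) (e i)
    have h2 : riemAt G x (e i) (e i) = 0 := by
      have : (2 : ℝ) • riemAt G x (e i) (e i) = 0 := by rw [two_smul]; nth_rw 1 [h]; simp
      exact (smul_eq_zero.mp this).resolve_left two_ne_zero
    rw [h2]; simp
  simp only [ricAt_eq_sum_of_orthonormal e he, Fin.sum_univ_three, hK0]
  rw [hK 0 1, hK 0 2, hK 1 2]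
  ring

variable {μ : Fin 3 → ℝ} (hμ : ∀ i w, ricAt G x (e i) w = μ i * G x (e i) w)
include hμ

/-- **The quadratic curvature term on an eigenvector**: for any basis `b`,
`Σ_{ij} g^{ij} Ric(R(bᵢ,e₀)e₀, bⱼ) = μ₁ G(R(e₁,e₀)e₀,e₁) + μ₂ G(R(e₂,e₀)e₀,e₂)` (the sum is
basis-independent; in the eigenframe `Ric(·, eᵢ) = μᵢ G(·, eᵢ)`).
[cite: EminentiLanaveMantegazza2008, §3 (p. 7)] [cite: ONeill1983, Ch. 3, Lemma 3.52] -/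
theorem IsMetricOn.rmRic_self_eq_of_eigenframe (hG : IsMetricOn G V) (hx : x ∈ V) :
    ∑ i, ∑ j, ginv G e x i j * ricAt G x (riemAt G x (e i) (e 0) (e 0)) (e j) =
      μ 1 * G x (riemAt G x (e 1) (e 0) (e 0)) (e 1)
        + μ 2 * G x (riemAt G x (e 2) (e 0) (e 0)) (e 2) := by
  have hi := hG.isInvertible x hx
  have hs := hG.symm x hx
  have hRic : ∀ u i, ricAt G x u (e i) = μ i * G x u (e i) := fun u i ↦ by
    rw [hG.ricAt_comm hx u (e i), hμ, hs]
  have h00 : G x (riemAt G x (e 0) (e 0) (e 0)) (e 0) = 0 := by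
    have h := riemAt_swap G x (e 0) (e 0)
    have h2 : riemAt G x (e 0) (e 0) = 0 := by
      have : (2 : ℝ) • riemAt G x (e 0) (e 0) = 0 := by rw [two_smul]; nth_rw 1 [h]; simp
      exact (smul_eq_zero.mp this).resolve_left two_ne_zero
    rw [h2]; simp
  rw [Finset.sum_comm]
  simp only [fun j ↦ Finset.sum_congr rfl fun i (_ : i ∈ Finset.univ) ↦
    (show ginv G e x i j * ricAt G x (riemAt G x (e i) (e 0) (e 0)) (e j) =
      ginv G e x j i * ricAt G x (riemAt G x (e i) (e 0) (e 0)) (e j) by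
        rw [ginv_comm e hi hs i j])]
  simp only [sum_ginv_mul_of_orthonormal e he hi, hRic, Fin.sum_univ_three, h00]
  ring

/-- **`2 Rm(Ric)(e₀,e₀) = μ₁(μ₀+μ₁−μ₂) + μ₂(μ₀+μ₂−μ₁)`** in dimension three.
[cite: EminentiLanaveMantegazza2008, §3 (p. 7)] [cite: Lee2018, Prop. 8.32] -/
theorem IsMetricOn.two_mul_rmRic_self_eq_of_eigenframe (hG : IsMetricOn G V) (hx : x ∈ V) :
    2 * ∑ i, ∑ j, ginv G e x i j * ricAt G x (riemAt G x (e i) (e 0) (e 0)) (e j) =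
      μ 1 * (μ 0 + μ 1 - μ 2) + μ 2 * (μ 0 + μ 2 - μ 1) := by
  rw [hG.rmRic_self_eq_of_eigenframe e he hμ hx]
  have hdiag : ∀ i, ricAt G x (e i) (e i) = μ i := fun i ↦ by rw [hμ, he]; simp
  -- the pair formula for `(e₀,e₁ | e₂)` and, after swapping `e₁ ↔ e₂`, for `(e₀,e₂ | e₁)`
  have h01 := hG.two_mul_sec_eq_of_orthonormal_three e he hx
  set e' : Basis (Fin 3) ℝ E := e.reindex (Equiv.swap 1 2) with he'def
  have he'0 : e' 0 = e 0 := by rw [he'def, Basis.reindex_apply]; rfl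
  have he'1 : e' 1 = e 2 := by rw [he'def, Basis.reindex_apply]; rfl
  have he'2 : e' 2 = e 1 := by rw [he'def, Basis.reindex_apply]; rfl
  have he' : ∀ i j, G x (e' i) (e' j) = if i = j then 1 else 0 := fun i j ↦ by
    rw [he'def, Basis.reindex_apply, Basis.reindex_apply, he]
    simp only [Equiv.symm_swap, Equiv.apply_eq_iff_eq]
  have h02 := hG.two_mul_sec_eq_of_orthonormal_three e' he' hx
  rw [he'0, he'1, he'2] at h02
  rw [hdiag, hdiag, hdiag] at h01 h02
  linear_combination μ 1 * h01 + μ 2 * h02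

/-- **Hamilton's identity on an eigenvector of `Ric`, dimension three**: on a gradient Ricci
soliton `Ric + Hess f = λG` on `V`, at `x ∈ V` with an orthonormal eigenframe `e` of `Ric_x`
(`Ric_x(eᵢ,·) = μᵢ G_x(eᵢ,·)`):
`(ΔRic)(e₀,e₀) − (∇_{♯Df}Ric)(e₀,e₀) = 2λμ₀ − μ₁(μ₀+μ₁−μ₂) − μ₂(μ₀+μ₂−μ₁)`
(`lapBilinAt_ricAt_of_soliton` and `two_mul_rmRic_self_eq_of_eigenframe`) — the curvature input of
Eminenti–La Nave–Mantegazza's computation of `Δ(R_{ij}/R)(p)vⁱvʲ` for `n = 3`.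
[cite: EminentiLanaveMantegazza2008, §3 (p. 7)] [cite: MunteanuWang2016, §2 (p. 6)] -/
theorem IsMetricOn.lapBilinAt_ricAt_self_of_soliton_eigenframe (hG : IsMetricOn G V) (hx : x ∈ V)
    {f : E → ℝ} {lam : ℝ} (hf : ContDiffOn ℝ ∞ f V)
    (hsol : ∀ y ∈ V, ∀ v w, ricAt G y v w + hessAt G f y v w = lam * G y v w) :
    lapBilinAt G (ricAt G) x (e 0) (e 0)
        - cov₂At G (ricAt G) x (sharpAt G x (fderiv ℝ f x)) (e 0) (e 0) =
      2 * lam * μ 0 - μ 1 * (μ 0 + μ 1 - μ 2) - μ 2 * (μ 0 + μ 2 - μ 1) := by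
  have h := hG.lapBilinAt_ricAt_of_soliton e hx hf hsol (e 0) (e 0)
  have h2 := hG.two_mul_rmRic_self_eq_of_eigenframe e he hμ hx
  have hdiag : ricAt G x (e 0) (e 0) = μ 0 := by rw [hμ, he]; simp
  rw [hdiag] at h
  linarith

end Three

end MetricCoord

end Literature.Geometry.Lorentzian

end
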